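import Summits.HodgeConjecture.CorCM.Census.QuarticInversionLaw
import Summits.HodgeConjecture.CorCM.Census.QuarticInversionBlockCount

/-!
# THE QUARTIC INVERSION LAWS over cyclic `B = ℤ/(2K+1)`: `μ(Dic(ℤ/4 × ℤ/(2K+1))) = β` and `μ(D(ℤ/4 × ℤ/(2K+1))) = β − 2`

COR-CM (cell `pub-hodgecm2`, stage 2 of the Hodge ladder), count-neutral KERNEL COMBINATORICS by the binder seat b23 (gen 44; claim
QUARTIC-INVERSION, HOME/INBOX.md l.12829).  Part XXVII of the lane `Census/QuarticInversion*`: theorems only, on top of part XXVI, BY NAME;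
no `decide`, no certificate, no named fact, no geometry, no `sorry`.  `Interfaces.lean` (C1), every E term, B01, `Transposition/*`,
`PortJoin/*` untouched.
HONEST FRAMING: `HC_CM` is NOT proved, here or anywhere in the tree; nothing here is a period, a count of record or a headline.

* §1 **The slot datum and the cross datum of `ℤ/(2K+1)`** (`exists_slot_datum`): `P = {0,…,K−2}`, `u₁ = K−1`, `u₂ = K` (so
  `P⁺ = {0,…,K}`), `Q = {0,…,K−1}`, `w = K`, `σ = K`, `s₀ = 0`: indeed `s + K ∈ {0,…,K} ↔ s ∈ {K+1,…,2K} ∪ {0}`.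
* §2 **THE LAWS for every `(G, c)` carrying a quartic inversion datum over `ℤ/m`, `m` odd `≥ 3`**: `μ(G, c) = β(G, c)` for `ζ = 1`
  (`isLeast_card_gfaces_generate_cyclic_one`; `G ≅ Dic(ℤ/4 × ℤ/m) = Dic(ℤ/4m)`, e.g. `Dic₆` for `m = 3`: EXACTLY `β = 172`) and
  `μ(G, c) = β(G, c) − 2` for `ζ = 0` (`isLeast_card_gfaces_generate_cyclic_zero`; `G ≅ D(ℤ/4m) = D_{4m}` with `c = r^{2m}`, e.g. `D₁₂`:
  `β = 204`, EXACTLY `202`); the rows `m = 3` with the block counts of `Census/QuarticInversionBlockCount.lean`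
  (`isLeast_card_gfaces_generate_oneHundredSeventyTwo`, `isLeast_card_gfaces_generate_twoHundredTwo`).  All [folklore].

## References
* [Pohlmann1968] H. Pohlmann, Algebraic cycles on abelian varieties of complex multiplication type, Ann. of Math. 88 (1968), Thm 1.
* [Milne1999] J. S. Milne, Lefschetz motives and the Tate conjecture, Compositio Math. 117 (1999), Prop. 2.1, p. 54.
-/

namespace Summit.HodgeConjecture.CorCM.Census.QuarticInversion

open Finset
open Summit.HodgeConjecture.CorCM.Prior.AllgGroup.RfwfAllgGroup
open Summit.HodgeConjecture.CorCM.Census.BlockParity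
open Summit.HodgeConjecture.CorCM.Census.Coinvariant

noncomputable section

/-! ## §1 The slot datum and the cross datum of a cyclic group of odd order -/

/-- In `ℤ/m` the residues of value `< j` number `j` (`j ≤ m`). [folklore] -/
theorem card_filter_val_lt (m : ℕ) [NeZero m] (j : ℕ) (hj : j ≤ m) :
    (univ.filter fun x : ZMod m => x.val < j).card = j := by
  have e : (univ.filter fun x : ZMod m => x.val < j) = (Finset.range j).image (fun n : ℕ => (n : ZMod m)) := by
    ext x
    simp only [mem_filter, mem_univ, true_and, mem_image, mem_range]
    constructor
    · intro hx; exact ⟨x.val, hx, ZMod.natCast_zmod_val x⟩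
    · rintro ⟨n, hn, rfl⟩; rw [ZMod.val_natCast_of_lt (by omega)]; exact hn
  rw [e, Finset.card_image_of_injOn, Finset.card_range]
  intro a ha b hb hab
  have ha' : a < j := Finset.mem_range.mp (Finset.mem_coe.mp ha)
  have hb' : b < j := Finset.mem_range.mp (Finset.mem_coe.mp hb)
  have := congrArg ZMod.val hab
  rwa [ZMod.val_natCast_of_lt (by omega), ZMod.val_natCast_of_lt (by omega)] at this

/-- **The slot datum and the cross datum of `ℤ/m`, `m = 2K + 1 ≥ 3`.** [folklore] -/
theorem exists_slot_datum (m : ℕ) [NeZero m] (hm : Odd m) (h3 : 3 ≤ m) :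
    ∃ (P : Finset (ZMod m)) (u₁ u₂ : ZMod m) (Q : Finset (ZMod m)) (w σ s₀ : ZMod m), u₁ ∉ P ∧ u₂ ∉ P ∧ u₁ ≠ u₂ ∧
      P.card + 1 = Fintype.card (ZMod m) / 2 ∧ s₀ ∈ insert u₁ (insert u₂ P) ∧
      (∀ s, s + σ ∈ insert u₁ (insert u₂ P) ↔ (s ∉ insert u₁ (insert u₂ P) ∨ s = s₀)) ∧ w ∉ Q ∧ Q.card = Fintype.card (ZMod m) / 2 := by
  obtain ⟨K, hK⟩ := hm
  have hK1 : 1 ≤ K := by omega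
  have vK : ((K : ℕ) : ZMod m).val = K := ZMod.val_natCast_of_lt (by omega)
  have vK1 : (((K - 1 : ℕ)) : ZMod m).val = K - 1 := ZMod.val_natCast_of_lt (by omega)
  refine ⟨univ.filter fun x : ZMod m => x.val < K - 1, ((K - 1 : ℕ) : ZMod m), ((K : ℕ) : ZMod m),
    univ.filter fun x : ZMod m => x.val < K, ((K : ℕ) : ZMod m), ((K : ℕ) : ZMod m), 0, ?_, ?_, ?_, ?_, ?_, ?_, ?_, ?_⟩
  · rw [mem_filter, vK1]; omega
  · rw [mem_filter, vK]; omega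
  · intro h; have := congrArg ZMod.val h; rw [vK1, vK] at this; omega
  · rw [card_filter_val_lt m (K - 1) (by omega), ZMod.card]; omega
  · -- membership in `P⁺` is `val ≤ K`
    have hmem : ∀ x : ZMod m, x ∈ insert (((K - 1 : ℕ)) : ZMod m) (insert ((K : ℕ) : ZMod m) (univ.filter fun x : ZMod m => x.val < K - 1))
        ↔ x.val ≤ K := by
      intro x
      rw [mem_insert, mem_insert, mem_filter]
      constructor
      · rintro (rfl | rfl | ⟨-, h⟩)
        · rw [vK1]; omega
        · rw [vK]
        · omega
      · intro hx
        by_cases h1 : x.val = K - 1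
        · exact Or.inl (ZMod.val_injective m (by rw [h1, vK1]))
        · by_cases h2 : x.val = K
          · exact Or.inr (Or.inl (ZMod.val_injective m (by rw [h2, vK])))
          · exact Or.inr (Or.inr ⟨mem_univ _, by omega⟩)
    rw [hmem, ZMod.val_zero]; exact Nat.zero_le K
  · have hmem : ∀ x : ZMod m, x ∈ insert (((K - 1 : ℕ)) : ZMod m) (insert ((K : ℕ) : ZMod m) (univ.filter fun x : ZMod m => x.val < K - 1))
        ↔ x.val ≤ K := by
      intro x
      rw [mem_insert, mem_insert, mem_filter]
      constructor
      · rintro (rfl | rfl | ⟨-, h⟩)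
        · rw [vK1]; omega
        · rw [vK]
        · omega
      · intro hx
        by_cases h1 : x.val = K - 1
        · exact Or.inl (ZMod.val_injective m (by rw [h1, vK1]))
        · by_cases h2 : x.val = K
          · exact Or.inr (Or.inl (ZMod.val_injective m (by rw [h2, vK])))
          · exact Or.inr (Or.inr ⟨mem_univ _, by omega⟩)
    intro s
    rw [hmem, hmem, ZMod.val_add, vK, ← ZMod.val_eq_zero]
    have hs := ZMod.val_lt s
    by_cases hlt : s.val + K < m
    · rw [Nat.mod_eq_of_lt hlt]; omega
    · rw [Nat.mod_eq_sub_mod (by omega), Nat.mod_eq_of_lt (by omega)]; omega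
  · rw [mem_filter, vK]; omega
  · rw [card_filter_val_lt m K (by omega), ZMod.card]; omega

/-! ## §2 The laws over cyclic groups of odd order -/

section Laws

variable {G : Type*} [Group G] [Fintype G] [DecidableEq G] {c : G} {m : ℕ} [NeZero m]

/-- **THE DICYCLIC QUARTIC LAW over `ℤ/m`** (`m` odd `≥ 3`; `G ≅ Dic(ℤ/4m)`): `μ(G, c) = β(G, c)`. [folklore] -/
theorem isLeast_card_gfaces_generate_cyclic_one (D : Datum G c (ZMod m) 1) (hc2 : c * c = 1) (hm : Odd m) (h3 : 3 ≤ m) :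
    IsLeast {n : ℕ | ∃ S : Finset (CMF G c →₀ ℤ), ↑S ⊆ gfaceSet G c hc2 ∧ S.card = n ∧
      hodgeSpan c hc2 ≤ Submodule.span ℤ (pairSet c) ⊔ Submodule.span ℤ (translates c S)} (Fintype.card (BlockParity.Block c)) :=
  isLeast_card_gfaces_generate_one D hc2 (by rw [ZMod.card]; exact hm) (by rw [ZMod.card]; exact h3) (exists_slot_datum m hm h3)

/-- **THE DIHEDRAL QUARTIC LAW over `ℤ/m`** (`m` odd `≥ 3`; `G ≅ D_{4m}`, `c = r^{2m}`): `μ(G, c) = β(G, c) − 2`. [folklore] -/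
theorem isLeast_card_gfaces_generate_cyclic_zero (D : Datum G c (ZMod m) 0) (hc2 : c * c = 1) (hm : Odd m) (h3 : 3 ≤ m) :
    IsLeast {n : ℕ | ∃ S : Finset (CMF G c →₀ ℤ), ↑S ⊆ gfaceSet G c hc2 ∧ S.card = n ∧
      hodgeSpan c hc2 ≤ Submodule.span ℤ (pairSet c) ⊔ Submodule.span ℤ (translates c S)} (Fintype.card (BlockParity.Block c) - 2) :=
  isLeast_card_gfaces_generate_zero D hc2 (by rw [ZMod.card]; exact hm) (by rw [ZMod.card]; exact h3) (exists_slot_datum m hm h3)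

/-- **Exact generating family, `ζ = 1`**: `S ⊆ gfaceSet` with `|S| = β(G, c)` generating. [folklore] -/
theorem exists_gfaces_generate_card_eq_cyclic_one (D : Datum G c (ZMod m) 1) (hc2 : c * c = 1) (hm : Odd m) (h3 : 3 ≤ m) :
    ∃ S : Finset (CMF G c →₀ ℤ), ↑S ⊆ gfaceSet G c hc2 ∧ S.card = Fintype.card (BlockParity.Block c) ∧
      hodgeSpan c hc2 ≤ Submodule.span ℤ (pairSet c) ⊔ Submodule.span ℤ (translates c S) :=
  (isLeast_card_gfaces_generate_cyclic_one D hc2 hm h3).1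

/-- **Exact generating family, `ζ = 0`**: `S ⊆ gfaceSet` with `|S| = β(G, c) − 2` generating. [folklore] -/
theorem exists_gfaces_generate_card_eq_cyclic_zero (D : Datum G c (ZMod m) 0) (hc2 : c * c = 1) (hm : Odd m) (h3 : 3 ≤ m) :
    ∃ S : Finset (CMF G c →₀ ℤ), ↑S ⊆ gfaceSet G c hc2 ∧ S.card = Fintype.card (BlockParity.Block c) - 2 ∧
      hodgeSpan c hc2 ≤ Submodule.span ℤ (pairSet c) ⊔ Submodule.span ℤ (translates c S) :=
  (isLeast_card_gfaces_generate_cyclic_zero D hc2 hm h3).1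

/-- **Row `Dic₆ = Dic(ℤ/12)` (order `24`, `ζ = 1`, `m = 3`): EXACTLY `172` faces** (`β = 172`). [folklore] -/
theorem isLeast_card_gfaces_generate_oneHundredSeventyTwo (D : Datum G c (ZMod m) 1) (hc2 : c * c = 1) (h3 : m = 3) :
    IsLeast {n : ℕ | ∃ S : Finset (CMF G c →₀ ℤ), ↑S ⊆ gfaceSet G c hc2 ∧ S.card = n ∧
      hodgeSpan c hc2 ≤ Submodule.span ℤ (pairSet c) ⊔ Submodule.span ℤ (translates c S)} 172 := by
  have h := isLeast_card_gfaces_generate_cyclic_one D hc2 (by rw [h3]; exact ⟨1, rfl⟩) (by omega)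
  rwa [card_block_eq_oneHundredSeventyTwo D hc2 (by rw [ZMod.card, h3])] at h

/-- **Row `D₁₂ = D(ℤ/12)` with `c = r⁶` (order `24`, `ζ = 0`, `m = 3`): EXACTLY `202` faces** (`β = 204`). [folklore] -/
theorem isLeast_card_gfaces_generate_twoHundredTwo (D : Datum G c (ZMod m) 0) (hc2 : c * c = 1) (h3 : m = 3) :
    IsLeast {n : ℕ | ∃ S : Finset (CMF G c →₀ ℤ), ↑S ⊆ gfaceSet G c hc2 ∧ S.card = n ∧
      hodgeSpan c hc2 ≤ Submodule.span ℤ (pairSet c) ⊔ Submodule.span ℤ (translates c S)} 202 := by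
  have h := isLeast_card_gfaces_generate_cyclic_zero D hc2 (by rw [h3]; exact ⟨1, rfl⟩) (by omega)
  rwa [card_block_eq_twoHundredFour D hc2 (by rw [ZMod.card, h3])] at h

end Laws

end

end Summit.HodgeConjecture.CorCM.Census.QuarticInversion
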